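import Literature.Algebra.EuclideanLattices.IntegerMatrixInverseGS
import HarnessLib

/-!
# Cohen's integral inverse, iterated: `invMatrix (invMatrix Uᵀ) = det(U)^{4n−4} · Uᵀ` (glue groundwork for MR07 Thm. 5.9 on a general integer lattice)

Topic `Algebra/EuclideanLattices` (family `pqc`). Groundwork for gluing a machine-level single attempt of
Micciancio–Regev 2007, Thm. 5.9 written in the `DualGrid` model (`DualGridCosetModel.lean`: the lattice is
presented as `Λ = G ℤⁿ` with `G = invMatrix B`, `B G = Dg I = G B`, `Dg = det(B)²`, for a PRIMAL integer
matrix `B`) to the solver interface of `MRThm59Shell` / `MRLemma510Dual` (an `IncGDD` instance carries an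
arbitrary nonsingular integer basis `U` of `Λ = L(U)`, rows). For such a `U` the primal matrix
`B' = invMatrix Uᵀ` presents a SCALED copy of `Λ`: all theorems proved here, for a nonsingular integer
matrix `X` (Cohen 1993 §2.6.3: `X · invMatrix X = det(X)² I`, `IntegerMatrixInverseGS.mul_invMatrix`):

* `invMatrix_mul_self` — `invMatrix X · X = det(X)² I` too (a one-sided inverse of a square matrix is
  two-sided; pass to `ℝ`);
* `det_invMatrix` — `det (invMatrix X) = det(X)^{2n−1}`;
* `invMatrix_invMatrix` — `invMatrix (invMatrix X) = det(X)^{4n−4} · X` (`n ≥ 1`);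
* `invMatrix_transpose_model` — for nonsingular `U` and `B' = invMatrix Uᵀ`: `B' Uᵀ = det(U)² I = Uᵀ B'`
  and `invMatrix B' = det(U)^{4n−4} · Uᵀ`, i.e. the `DualGrid` lattice of `B'` is `det(U)^{4n−4} · L(U)`.

## References

* H. Cohen, *A Course in Computational Algebraic Number Theory*, GTM 138, Springer 1993, §2.6.3 [Cohen1993].
* D. Micciancio, S. Goldwasser, *Complexity of Lattice Problems*, Kluwer 2002, Ch. 1 §1 (bases, duality,
  scaling) [MicciancioGoldwasser2002].
-/

noncomputable section

namespace Literature.Algebra.EuclideanLattices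

namespace MRThm59

open Matrix GSInverse

variable {n : ℕ}

/-- Casting integer matrices to `ℝ` is injective. [folklore] -/
theorem map_intCast_injective : Function.Injective fun M : Matrix (Fin n) (Fin n) ℤ => M.map (Int.cast : ℤ → ℝ) :=
  fun M M' h => Matrix.ext fun i j => by
    have := congrFun (congrFun h i) j
    simpa [Matrix.map_apply] using this

/-- The real determinant of a nonsingular integer matrix is a unit. [folklore] -/
theorem isUnit_det_map {X : Matrix (Fin n) (Fin n) ℤ} (hX : X.det ≠ 0) : IsUnit (X.map (Int.cast : ℤ → ℝ)).det := by
  rw [show X.map (Int.cast : ℤ → ℝ) = (Int.castRingHom ℝ).mapMatrix X from rfl, ← RingHom.map_det, isUnit_iff_ne_zero, eq_intCast]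
  exact_mod_cast hX

/-- Over `ℝ`: `invMatrix X = det(X)² · X⁻¹`. [cite: Cohen1993, §2.6.3] -/
theorem invMatrix_map_eq {X : Matrix (Fin n) (Fin n) ℤ} (hX : X.det ≠ 0) :
    (invMatrix X).map (Int.cast : ℤ → ℝ) = ((X.det : ℝ) ^ 2) • (X.map (Int.cast : ℤ → ℝ))⁻¹ := by
  have hd2 : ((X.det : ℝ) ^ 2) ≠ 0 := pow_ne_zero 2 (by exact_mod_cast hX)
  rw [inv_eq_smul_invMatrix hX, smul_smul, mul_inv_cancel₀ hd2, one_smul]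

/-- **`invMatrix X · X = det(X)² I`**: the integral inverse is two-sided. [cite: Cohen1993, §2.6.3] -/
theorem invMatrix_mul_self {X : Matrix (Fin n) (Fin n) ℤ} (hX : X.det ≠ 0) :
    invMatrix X * X = (X.det ^ 2) • (1 : Matrix (Fin n) (Fin n) ℤ) := by
  apply map_intCast_injective
  have e2 : (invMatrix X * X).map (Int.cast : ℤ → ℝ) = (invMatrix X).map (Int.cast : ℤ → ℝ) * X.map (Int.cast : ℤ → ℝ) :=
    Matrix.map_mul (f := Int.castRingHom ℝ)
  show (invMatrix X * X).map (Int.cast : ℤ → ℝ) = ((X.det ^ 2) • (1 : Matrix (Fin n) (Fin n) ℤ)).map (Int.cast : ℤ → ℝ)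
  rw [e2, invMatrix_map_eq hX, Matrix.smul_mul, Matrix.nonsing_inv_mul _ (isUnit_det_map hX)]
  ext i j
  rw [Matrix.map_apply, Matrix.smul_apply, Matrix.smul_apply, Matrix.one_apply, Matrix.one_apply]
  split_ifs <;> simp

/-- **`det (invMatrix X) · det X = det(X)^{2n}`.** [cite: Cohen1993, §2.6.3] -/
theorem det_invMatrix_mul_det {X : Matrix (Fin n) (Fin n) ℤ} (hX : X.det ≠ 0) :
    (invMatrix X).det * X.det = X.det ^ (2 * n) := by
  have h := congrArg Matrix.det (invMatrix_mul_self hX)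
  rw [Matrix.det_mul, Matrix.det_smul, Matrix.det_one, mul_one, Fintype.card_fin, ← pow_mul] at h
  rw [h, mul_comm]

/-- **`det (invMatrix X) = det(X)^{2n−1}`** (`n ≥ 1`). [cite: Cohen1993, §2.6.3] -/
theorem det_invMatrix {X : Matrix (Fin n) (Fin n) ℤ} (hX : X.det ≠ 0) (hn : 1 ≤ n) :
    (invMatrix X).det = X.det ^ (2 * n - 1) := by
  have h := det_invMatrix_mul_det hX
  have hsplit : X.det ^ (2 * n) = X.det ^ (2 * n - 1) * X.det := by
    rw [← pow_succ]; congr 1; omega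
  rw [hsplit] at h
  exact mul_right_cancel₀ hX h

/-- **`invMatrix (invMatrix X) = det(X)^{4n−4} · X`** (`n ≥ 1`): the iterated integral inverse is a scaled
copy (from `invMatrix G · G · X` computed both ways, `G = invMatrix X`; integers only). [cite: Cohen1993, §2.6.3] -/
theorem invMatrix_invMatrix {X : Matrix (Fin n) (Fin n) ℤ} (hX : X.det ≠ 0) (hn : 1 ≤ n) :
    invMatrix (invMatrix X) = (X.det ^ (4 * n - 4)) • X := by
  set G := invMatrix X with hGdef
  have hGdet : G.det = X.det ^ (2 * n - 1) := det_invMatrix hX hn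
  have hG : G.det ≠ 0 := by rw [hGdet]; exact pow_ne_zero _ hX
  have h1 : invMatrix G * G * X = (G.det ^ 2) • X := by
    rw [invMatrix_mul_self hG, Matrix.smul_mul, Matrix.one_mul]
  have h2 : invMatrix G * G * X = (X.det ^ 2) • invMatrix G := by
    rw [Matrix.mul_assoc, hGdef, invMatrix_mul_self hX, Matrix.mul_smul, Matrix.mul_one]
  have h3 : (X.det ^ 2) • invMatrix G = (X.det ^ 2) • ((X.det ^ (4 * n - 4)) • X) := by
    rw [← h2, h1, smul_smul, ← pow_add, hGdet, ← pow_mul]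
    congr 2; omega
  exact smul_right_injective (Matrix (Fin n) (Fin n) ℤ) (pow_ne_zero 2 hX) h3

/-- **The `DualGrid` model of a general integer lattice**: for a nonsingular integer `U` (rows a basis of
`Λ = L(U)`) and `B' = invMatrix Uᵀ`: `Uᵀ · B' = det(U)² I = B' · Uᵀ` and `invMatrix B' = det(U)^{4n−4} · Uᵀ`
— so presenting the lattice by the primal matrix `B'` yields the SCALED copy `det(U)^{4n−4} · Λ`
(columns of `invMatrix B'`), with `Dg = det(B')² = det(U)^{4n−2}`. [cite: MicciancioGoldwasser2002, Ch. 1 §1; Cohen1993 §2.6.3] -/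
theorem invMatrix_transpose_model {U : Matrix (Fin n) (Fin n) ℤ} (hU : U.det ≠ 0) (hn : 1 ≤ n) :
    U.transpose * invMatrix U.transpose = (U.det ^ 2) • (1 : Matrix (Fin n) (Fin n) ℤ) ∧
      invMatrix U.transpose * U.transpose = (U.det ^ 2) • (1 : Matrix (Fin n) (Fin n) ℤ) ∧
      invMatrix (invMatrix U.transpose) = (U.det ^ (4 * n - 4)) • U.transpose ∧
      (invMatrix U.transpose).det = U.det ^ (2 * n - 1) := by
  have hUt : U.transpose.det ≠ 0 := by rwa [Matrix.det_transpose]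
  refine ⟨?_, ?_, ?_, ?_⟩
  · rw [mul_invMatrix hUt, Matrix.det_transpose]
  · rw [invMatrix_mul_self hUt, Matrix.det_transpose]
  · rw [invMatrix_invMatrix hUt hn, Matrix.det_transpose]
  · rw [det_invMatrix hUt hn, Matrix.det_transpose]

end MRThm59

end Literature.Algebra.EuclideanLattices

end
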